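import Summits.ResolutionOfSingularities.ResolutionOfSingularities.Theorems.FrobeniusClosingPatchingRelPerfectConeDepthChartKill
import Mathlib.RingTheory.RegularLocalRing.Polynomial
import HarnessLib

/-!
# Crux `PatchingRelPerfect` (stmt-ResolutionOfSingularities-16161), chain W5.2 — rung tool: KILLING CHART GENERATORS AND ONE
# HYPERSURFACE with coefficients in a REGULAR DOMAIN (centres of positive dimension: `B_i/(c_i) ≅ (R/I)[T]`, `R/I` regular)

[OURS · L1 W5.2 · rung tool] Replaces the role of NO printed item; NOT a statement of the manuscript under review; fact-free.
AI-written (AI review is weaker than expert review).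

`…ConeDepthChartAlgebra` / `…ConeDepthChartKill` treat the charts of the blowing up of a CLOSED POINT: modulo the exceptional
parameter the chart ring is a polynomial ring over the residue FIELD.  For the blowing up of a regular centre `V(c₁, …, c_n)` of
positive dimension (the LINE-centre ladder of the anisotropic binary form, `…ConeDepthLine*`) the chart ring modulo `c_i` is a
polynomial ring over the regular local ring `R/(c)` (the tree's `chartQuotEquiv`).  This file redoes the two abstract statements
with an ARBITRARY coefficient ring `C` given with `ε : C[T_j : j ≠ i] ≅ A/(ψ c_i)`:
* `isRsopPart_consFamily_of_equiv` — `(ψ c_i, f₁, …, f_m)` is part of a regular system of parameters of `L = A_𝔓` when the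
  `f_k ∈ 𝔓` have representatives forming a weakly regular sequence on `C[T]` and `L/(ψ c_i, f)L` is regular (flatness of the
  localisation `L/(ψ c_i)L` over `C[T]`, dimension count by the regular sequence);
* `isRsopPart_kill_hypersurface_of_equiv` — for `C` a regular domain: killed generators `u_l ∈ 𝔓` and one `f ∈ 𝔓` with a
  representative `F ∈ C[T_j : j ∉ l]`, `F ≠ 0`, some `∂F/∂T_j` lifting outside `𝔓` ⟹ `(ψ c_i, u_l, f)` is part of a regular
  system of parameters of `L` (Jacobian criterion over the regular ring `C[T_j : j ∉ l]`, Mathlib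
  `MvPolynomial.isRegularRing_of_isRegularRing`).

## References
* H. Matsumura, *Commutative Ring Theory*, CUP 1986, Thm. 14.2 (Remark), Thm. 17.4, Thm. 30.3. [Matsumura1987]
* The Stacks Project, Tags 0804, 0BIQ. [StacksProject]
-/

set_option linter.dupNamespace false

noncomputable section

open IsLocalRing Literature.AlgebraicGeometry.Resolution
open scoped Pointwise

namespace Summit.ResolutionOfSingularities.ResolutionOfSingularities.Theorems

universe u v

namespace ConeDepth

/-! ## §1 The abstract chart over an arbitrary coefficient ring -/

section AbstractChartC

variable {R : Type u} [CommRing R] [IsRegularLocalRing R] {n : ℕ} (c : Fin n → R) (i : Fin n)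
  {A : Type u} [CommRing A] (L : Type u) [CommRing L] (ψ : R →+* A) (u : Fin n → A)
  (hnzd : ψ (c i) ∈ nonZeroDivisors A)
  {C : Type u} [CommRing C]
  (ε : MvPolynomial {j : Fin n // j ≠ i} C ≃+* A ⧸ Ideal.span {ψ (c i)})
  (hεX : ∀ j : {j : Fin n // j ≠ i}, ε (MvPolynomial.X j) = Ideal.Quotient.mk _ (u j.1))
  (𝔓 : Ideal A) [𝔓.IsPrime] (hci : ψ (c i) ∈ 𝔓)
  [Algebra A L] [IsLocalization.AtPrime L 𝔓]

local notation3 "P" => MvPolynomial {j : Fin n // j ≠ i} C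
local notation3 "KA" => Ideal.span {ψ (c i)}
local notation3 "KL" => Ideal.map (algebraMap A L) (Ideal.span {ψ (c i)})
local notation3 "Lb" => L ⧸ KL

include hci in
omit [IsRegularLocalRing R] in
/-- All members of `(ψ c_i, f)` lie in the maximal ideal of `L` (if `ψ c_i` and the `f_k` lie in `𝔓`). [folklore] -/
theorem consFamily_mem_maximalIdeal' [IsLocalRing L] {m : ℕ} (f : Fin m → A) (hf : ∀ k, f k ∈ 𝔓)
    (k : Fin (m + 1)) : consFamily c i L ψ f k ∈ maximalIdeal L := by
  have hmem : ∀ a' ∈ 𝔓, algebraMap A L a' ∈ maximalIdeal L := fun a' ha' =>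
    (IsLocalization.AtPrime.to_map_mem_maximal_iff L 𝔓 a').mpr ha'
  refine Fin.cases ?_ (fun k => ?_) k
  · exact hmem _ hci
  · simp only [consFamily, Fin.cons_succ]
    exact hmem _ (hf k)

include hnzd 𝔓 in
omit [IsRegularLocalRing R] in
/-- **The family is weakly regular on `L`** when the representatives `F_k ∈ C[T]` of the `f_k` modulo `ψ c_i` form a weakly
regular sequence on `C[T]`: `ψ c_i` is a non-zero-divisor, and modulo it the `f_k` are the images of the `F_k` in the flat
`C[T]`-algebra `L/(ψ c_i)L` (a localisation of `A/(ψ c_i) ≅ C[T]`). [folklore] -/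
theorem isWeaklyRegular_consFamily_of_equiv {m : ℕ} (f : Fin m → A) (F : Fin m → P)
    (hfF : ∀ k, ε (F k) = Ideal.Quotient.mk _ (f k))
    (hF : RingTheory.Sequence.IsWeaklyRegular P (List.ofFn F)) :
    RingTheory.Sequence.IsWeaklyRegular L (List.ofFn (consFamily c i L ψ f)) := by
  rw [ofFn_consFamily, RingTheory.Sequence.isWeaklyRegular_cons_iff]
  constructor
  · exact Module.Flat.isSMulRegular_of_nonZeroDivisors
      (algebraMap_centre_mem_nonZeroDivisors c i L ψ hnzd 𝔓)
  · letI : Algebra P Lb := ((algebraMap (A ⧸ KA) Lb).comp ε.symm.symm.toRingHom).toAlgebra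
    haveI : Module.Flat P Lb := by
      have hloc := IsLocalization.isLocalization_of_base_ringEquiv
        (Algebra.algebraMapSubmonoid (A ⧸ KA) 𝔓.primeCompl) (Lb) ε.symm
      exact @IsLocalization.flat _ (Lb) _ _ (((algebraMap (A ⧸ KA) Lb).comp ε.symm.symm.toRingHom).toAlgebra) _ hloc
    have hLbar := hF.of_flat (S := Lb)
    rw [List.map_ofFn] at hLbar
    have halg : ∀ k, algebraMap P Lb (F k) = Ideal.Quotient.mk KL (algebraMap A L (f k)) := by
      intro k
      change (algebraMap (A ⧸ KA) Lb) (ε.symm.symm (F k)) = _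
      rw [RingEquiv.symm_symm, hfF]
      rfl
    simp only [Function.comp_def, halg] at hLbar
    have hLbar' : RingTheory.Sequence.IsWeaklyRegular Lb (List.ofFn fun k => algebraMap A L (f k)) := by
      rw [← RingTheory.Sequence.isWeaklyRegular_map_algebraMap_iff Lb, List.map_ofFn]
      exact hLbar
    have hKL : (algebraMap A L (ψ (c i)) • ⊤ : Submodule L L) = (KL).restrictScalars L := by
      rw [Ideal.map_span, Set.image_singleton, ← Submodule.ideal_span_singleton_smul, smul_eq_mul,
        Ideal.mul_top]
      rfl
    let eq : QuotSMulTop (algebraMap A L (ψ (c i))) L ≃ₗ[L] Lb := Submodule.quotEquivOfEq _ _ hKL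
    exact (eq.isWeaklyRegular_congr _).mpr hLbar'

include hnzd hci in
omit [IsRegularLocalRing R] in
/-- The family is a regular sequence on `L` (weakly regular, and its ideal is proper). [folklore] -/
theorem isRegular_consFamily_of_equiv [IsLocalRing L] {m : ℕ} (f : Fin m → A) (hf : ∀ k, f k ∈ 𝔓)
    (F : Fin m → P) (hfF : ∀ k, ε (F k) = Ideal.Quotient.mk _ (f k))
    (hF : RingTheory.Sequence.IsWeaklyRegular P (List.ofFn F)) :
    RingTheory.Sequence.IsRegular L (List.ofFn (consFamily c i L ψ f)) := by
  refine ⟨isWeaklyRegular_consFamily_of_equiv c i L ψ hnzd ε 𝔓 f F hfF hF, ?_⟩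
  rw [smul_eq_mul, Ideal.mul_top, Ideal.ofList_ofFn]
  intro htop
  have h1 : (Ideal.span (Set.range (consFamily c i L ψ f))) ≤ maximalIdeal L :=
    Ideal.span_le.mpr (by rintro _ ⟨k, rfl⟩; exact consFamily_mem_maximalIdeal' c i L ψ 𝔓 hci f hf k)
  rw [← htop] at h1
  exact (maximalIdeal.isMaximal L).ne_top (top_le_iff.mp h1)

include hnzd hci in
omit [IsRegularLocalRing R] in
/-- **Dimension count**: `dim L/(ψ c_i, f) + (m + 1) = dim L`. [cite: Matsumura1987, Thm. 17.4] -/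
theorem ringKrullDim_quot_consFamily_add_of_equiv [IsNoetherianRing A] [IsLocalRing L] {m : ℕ}
    (f : Fin m → A) (hf : ∀ k, f k ∈ 𝔓)
    (F : Fin m → P) (hfF : ∀ k, ε (F k) = Ideal.Quotient.mk _ (f k))
    (hF : RingTheory.Sequence.IsWeaklyRegular P (List.ofFn F)) :
    ringKrullDim (L ⧸ Ideal.span (Set.range (consFamily c i L ψ f))) + (m + 1 : ℕ) = ringKrullDim L := by
  haveI : IsNoetherianRing L := IsLocalization.isNoetherianRing 𝔓.primeCompl L inferInstance
  have h := Module.supportDim_add_length_eq_supportDim_of_isRegular (M := L) _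
    (isRegular_consFamily_of_equiv c i L ψ hnzd ε 𝔓 hci f hf F hfF hF)
  rw [List.length_ofFn, Module.supportDim_self_eq_ringKrullDim] at h
  rw [← h, ← Module.supportDim_quotient_eq_ringKrullDim]
  congr 1
  refine Module.supportDim_eq_of_equiv (Submodule.quotEquivOfEq _ _ ?_)
  rw [smul_eq_mul, Ideal.mul_top, Ideal.ofList_ofFn]

include hnzd hci in
omit [IsRegularLocalRing R] in
/-- **Main abstract statement over `C`.**  If the `f_k ∈ 𝔓` have representatives in `C[T]` forming a weakly regular sequence,
and `L/(ψ c_i, f)L` is a regular local ring, then `(ψ c_i, f₁, …, f_m)` is part of a regular system of parameters of `L`.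
[cite: Matsumura1987, Thm. 14.2 (Remark)] -/
theorem isRsopPart_consFamily_of_equiv [IsNoetherianRing A] [IsLocalRing L] {m : ℕ}
    (f : Fin m → A) (hf : ∀ k, f k ∈ 𝔓)
    (F : Fin m → P) (hfF : ∀ k, ε (F k) = Ideal.Quotient.mk _ (f k))
    (hF : RingTheory.Sequence.IsWeaklyRegular P (List.ofFn F))
    [hreg : IsRegularLocalRing (L ⧸ (Ideal.ofList (ψ (c i) :: List.ofFn f)).map (algebraMap A L))] :
    IsRsopPart (consFamily c i L ψ f) := by
  haveI : IsNoetherianRing L := IsLocalization.isNoetherianRing 𝔓.primeCompl L inferInstance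
  haveI : IsRegularLocalRing (L ⧸ Ideal.span (Set.range (consFamily c i L ψ f))) := by
    rw [span_range_consFamily]; exact hreg
  refine IsRsopPart.of_isRegularLocalRing_quotient (consFamily_mem_maximalIdeal' c i L ψ 𝔓 hci f hf) ?_
  exact (ringKrullDim_quot_consFamily_add_of_equiv c i L ψ hnzd ε 𝔓 hci f hf F hfF hF).le

end AbstractChartC

/-! ## §2 Killing chart generators and one hypersurface over a regular domain -/

section KillC

variable {R : Type u} [CommRing R] [IsRegularLocalRing R] {n : ℕ} (c : Fin n → R) (i : Fin n)
  {A : Type u} [CommRing A] (L : Type u) [CommRing L] (ψ : R →+* A) (u : Fin n → A)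
  (hnzd : ψ (c i) ∈ nonZeroDivisors A)
  {C : Type u} [CommRing C] [IsDomain C] [IsRegularRing C]
  (ε : MvPolynomial {j : Fin n // j ≠ i} C ≃+* A ⧸ Ideal.span {ψ (c i)})
  (hεX : ∀ j : {j : Fin n // j ≠ i}, ε (MvPolynomial.X j) = Ideal.Quotient.mk _ (u j.1))
  (𝔓 : Ideal A) [𝔓.IsPrime] (hci : ψ (c i) ∈ 𝔓)
  [Algebra A L] [IsLocalization.AtPrime L 𝔓]
  (l : List {j : Fin n // j ≠ i}) (hl : l.Nodup)

local notation3 "P" => MvPolynomial {j : Fin n // j ≠ i} C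
local notation3 "KA" => Ideal.span {ψ (c i)}
local notation3 "sl" => {j : {j : Fin n // j ≠ i} | j ∈ l}
local notation3 "Ps" => MvPolynomial {j : {j : Fin n // j ≠ i} // j ∉ {j : {j : Fin n // j ≠ i} | j ∈ l}} C

include hεX in
omit [IsRegularLocalRing R] [𝔓.IsPrime] [IsLocalization.AtPrime L 𝔓] [Algebra A L] [IsDomain C] [IsRegularRing C] in
/-- Modulo `ψ c_i`, the ideal `K₀ = (ψ c_i, u_l, f)` is the image under `ε` of `(T_l, F)`. [folklore] -/
theorem map_mk_killIdeal_of_equiv (f : A) (F : Ps)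
    (hfF : ε (MvPolynomial.rename Subtype.val F) = Ideal.Quotient.mk _ f) :
    (killIdeal c i ψ u l f).map (Ideal.Quotient.mk KA) =
      (Ideal.span (MvPolynomial.X '' sl) ⊔ Ideal.span {MvPolynomial.rename Subtype.val F}).map
        (ε : P →+* A ⧸ KA) := by
  have h0 : Ideal.span {Ideal.Quotient.mk KA (ψ (c i))} = ⊥ :=
    Ideal.span_singleton_eq_bot.mpr (Ideal.Quotient.eq_zero_iff_mem.mpr (Ideal.subset_span rfl))
  rw [killIdeal, ofFn_killFamily, Ideal.map_ofList, List.map_cons, Ideal.ofList_cons, h0, bot_sup_eq,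
    List.map_append, Ideal.ofList_append, Ideal.map_sup, Ideal.map_span, Ideal.map_span, Set.image_singleton]
  congr 1
  · rw [Ideal.ofList, List.map_map]
    congr 1
    ext x
    simp only [Set.mem_setOf_eq, List.mem_map, Function.comp_apply, Set.mem_image]
    constructor
    · rintro ⟨j, hj, rfl⟩
      exact ⟨MvPolynomial.X j, ⟨j, hj, rfl⟩, by rw [RingHom.coe_coe, hεX]⟩
    · rintro ⟨_, ⟨j, hj, rfl⟩, rfl⟩
      exact ⟨j, hj, by rw [RingHom.coe_coe, hεX]⟩
  · rw [Ideal.ofList, List.map_singleton, RingHom.coe_coe, hfF]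
    congr 1
    ext x
    simp

include hεX in
omit [IsRegularLocalRing R] [𝔓.IsPrime] [IsLocalization.AtPrime L 𝔓] [Algebra A L] [IsDomain C] [IsRegularRing C] in
/-- **`A/K₀ ≅ C[T_j : j ∉ l]/(F)`**, sending the class of `a` to the class of `G` whenever `ε(G) = ā` (`G` not involving the
killed variables). [folklore] -/
theorem exists_quotKillIdealEquiv_of_equiv (f : A) (F : Ps)
    (hfF : ε (MvPolynomial.rename Subtype.val F) = Ideal.Quotient.mk _ f) :
    ∃ eK : (A ⧸ killIdeal c i ψ u l f) ≃+* Ps ⧸ Ideal.span {F},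
      ∀ (a : A) (G : Ps), ε (MvPolynomial.rename Subtype.val G) = Ideal.Quotient.mk _ a →
        eK (Ideal.Quotient.mk _ a) = Ideal.Quotient.mk _ G := by
  have hle := span_le_killIdeal c i ψ u l f
  have hK₀ := map_mk_killIdeal_of_equiv c i ψ u ε hεX l f F hfF
  -- kill the variables: `C[T]/(T_l, F) ≅ C[T_j : j ∉ l]/(F)`
  have hIJ : Ideal.span {F} =
      Ideal.map (((MvPolynomial.quotientSpanXEquiv (R := C) sl).toRingEquiv :
          (P ⧸ Ideal.span (MvPolynomial.X '' sl : Set P)) ≃+* Ps) : (P ⧸ Ideal.span (MvPolynomial.X '' sl : Set P)) →+* Ps)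
        (Ideal.map (Ideal.Quotient.mk (Ideal.span (MvPolynomial.X '' sl : Set P)))
          (Ideal.span {(MvPolynomial.rename Subtype.val F : P)})) := by
    rw [Ideal.map_map, Ideal.map_span, Set.image_singleton]
    congr 2
    change F = MvPolynomial.quotientSpanXEquiv sl (Ideal.Quotient.mk _ (MvPolynomial.rename Subtype.val F))
    rw [MvPolynomial.quotientSpanXEquiv_mk, MvPolynomial.killCompl_rename_app]
  obtain ⟨eKill, heKill⟩ : ∃ eKill :
      (P ⧸ (Ideal.span (MvPolynomial.X '' sl) ⊔ Ideal.span {MvPolynomial.rename Subtype.val F})) ≃+* Ps ⧸ Ideal.span {F},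
      ∀ G : Ps, eKill (Ideal.Quotient.mk _ (MvPolynomial.rename Subtype.val G)) = Ideal.Quotient.mk _ G := by
    refine ⟨(DoubleQuot.quotQuotEquivQuotSup (Ideal.span (MvPolynomial.X '' sl : Set P))
        (Ideal.span {(MvPolynomial.rename Subtype.val F : P)})).symm.trans
      (Ideal.quotientEquiv
        (Ideal.map (Ideal.Quotient.mk (Ideal.span (MvPolynomial.X '' sl : Set P)))
          (Ideal.span {(MvPolynomial.rename Subtype.val F : P)}))
        (Ideal.span {F}) (MvPolynomial.quotientSpanXEquiv sl).toRingEquiv hIJ), fun G => ?_⟩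
    rw [RingEquiv.trans_apply, DoubleQuot.quotQuotEquivQuotSup_symm_quotQuotMk, DoubleQuot.quotQuotMk,
      RingHom.comp_apply]
    erw [Ideal.quotientEquiv_mk]
    change Ideal.Quotient.mk _ (MvPolynomial.quotientSpanXEquiv sl (Ideal.Quotient.mk _ _)) = _
    rw [MvPolynomial.quotientSpanXEquiv_mk, MvPolynomial.killCompl_rename_app]
  let e2 : (P ⧸ (Ideal.span (MvPolynomial.X '' sl) ⊔ Ideal.span {MvPolynomial.rename Subtype.val F})) ≃+*
      (A ⧸ KA) ⧸ (killIdeal c i ψ u l f).map (Ideal.Quotient.mk KA) :=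
    Ideal.quotientEquiv _ _ ε hK₀
  refine ⟨((DoubleQuot.quotQuotEquivQuotOfLE hle).symm.trans e2.symm).trans eKill, fun a G hG => ?_⟩
  rw [RingEquiv.trans_apply, RingEquiv.trans_apply, DoubleQuot.quotQuotEquivQuotOfLE_symm_mk]
  have h2 : e2 (Ideal.Quotient.mk _ (MvPolynomial.rename Subtype.val G)) =
      DoubleQuot.quotQuotMk KA (killIdeal c i ψ u l f) a := by
    change Ideal.Quotient.mk _ (ε _) = _
    rw [hG]
    rfl
  rw [← h2, RingEquiv.symm_apply_apply, heKill]

include hεX in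
omit [𝔓.IsPrime] [IsLocalization.AtPrime L 𝔓] [Algebra A L] [IsRegularLocalRing R] [IsDomain C] in
/-- **Regularity of `A/K₀` at the prime `𝔓/K₀` by the Jacobian criterion over the regular ring `C[T_j : j ∉ l]`**: if some partial
derivative `∂F/∂T_j` has a lift `a ∉ 𝔓`, then `A/K₀ ≅ C[T_j : j ∉ l]/(F)` is regular at `𝔓/K₀`. [cite: Matsumura1987, Thm. 30.3] -/
theorem isRegularLocalRing_atPrime_killIdeal_of_equiv (f : A) (F : Ps)
    (hfF : ε (MvPolynomial.rename Subtype.val F) = Ideal.Quotient.mk _ f)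
    (hK : killIdeal c i ψ u l f ≤ 𝔓) (jv : {j : {j : Fin n // j ≠ i} // j ∉ sl}) (a : A)
    (hGa : ε (MvPolynomial.rename Subtype.val (MvPolynomial.pderiv jv F)) = Ideal.Quotient.mk _ a) (ha : a ∉ 𝔓)
    [(𝔓.map (Ideal.Quotient.mk (killIdeal c i ψ u l f))).IsPrime] :
    IsRegularLocalRing (Localization.AtPrime (𝔓.map (Ideal.Quotient.mk (killIdeal c i ψ u l f)))) := by
  classical
  haveI : IsRegularRing Ps := inferInstance
  obtain ⟨eK, heK⟩ := exists_quotKillIdealEquiv_of_equiv c i ψ u ε hεX l f F hfF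
  set pbar := 𝔓.map (Ideal.Quotient.mk (killIdeal c i ψ u l f)) with hpbar
  have hG : Ideal.Quotient.mk _ (MvPolynomial.pderiv jv F) ∉ pbar.comap eK.symm := by
    intro hmem
    rw [Ideal.mem_comap, ← heK a _ hGa, RingEquiv.symm_apply_apply, hpbar, ← Ideal.mem_comap,
      Ideal.comap_map_of_surjective _ Ideal.Quotient.mk_surjective, ← RingHom.ker_eq_comap_bot, Ideal.mk_ker,
      sup_eq_left.mpr hK] at hmem
    exact ha hmem
  haveI := MvPolynomial.isRegularLocalRing_atPrime_quotient_of_pderiv_notMem (pbar.comap eK.symm) jv hG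
  exact isRegularLocalRing_atPrime_of_ringEquiv eK.symm pbar

include hl hnzd hεX hci in
omit [IsRegularLocalRing R] in
/-- **The chart family with killed generators and one hypersurface is part of a regular system of parameters of `L`** (coefficient
ring a regular domain `C`): for a duplicate-free list `l` of indices `j ≠ i` with `u_j ∈ 𝔓`, and `f ∈ 𝔓` with a non-zero
representative `F ∈ C[T_j : j ∉ l]` some partial derivative of which has a lift `a ∉ 𝔓`, the family `(ψ c_i, u_l, f)` is part of a
regular system of parameters of `L`. [cite: Matsumura1987, Thm. 14.2, Thm. 30.3] -/
theorem isRsopPart_kill_hypersurface_of_equiv [IsNoetherianRing A] [IsLocalRing L]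
    (hlu : ∀ j ∈ l, u j.1 ∈ 𝔓) (f : A) (hf : f ∈ 𝔓) (F : Ps) (hF0 : F ≠ 0)
    (hfF : ε (MvPolynomial.rename Subtype.val F) = Ideal.Quotient.mk _ f)
    (jv : {j : {j : Fin n // j ≠ i} // j ∉ sl}) (a : A)
    (hGa : ε (MvPolynomial.rename Subtype.val (MvPolynomial.pderiv jv F)) = Ideal.Quotient.mk _ a) (ha : a ∉ 𝔓) :
    IsRsopPart (consFamily c i L ψ (killFamily i u l f)) := by
  classical
  have hK : killIdeal c i ψ u l f ≤ 𝔓 := by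
    rw [killIdeal, ofFn_killFamily, Ideal.ofList, Ideal.span_le]
    intro x hx
    simp only [Set.mem_setOf_eq, List.mem_cons, List.mem_append, List.mem_map, List.not_mem_nil, or_false] at hx
    rcases hx with rfl | ⟨j, hj, rfl⟩ | rfl
    · exact hci
    · exact hlu j hj
    · exact hf
  haveI := isPrime_map_mk 𝔓 _ hK
  haveI := isRegularLocalRing_atPrime_killIdeal_of_equiv c i ψ u ε hεX 𝔓 l f F hfF hK jv a hGa ha
  haveI : IsRegularLocalRing (L ⧸ (Ideal.ofList (ψ (c i) :: List.ofFn (killFamily i u l f))).map (algebraMap A L)) := by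
    have h := isRegularLocalRing_quot_map_of_atPrime L 𝔓 (killIdeal c i ψ u l f) hK
    rwa [killIdeal] at h
  refine isRsopPart_consFamily_of_equiv c i L ψ hnzd ε 𝔓 hci _ ?_
    (Fin.append (fun k : Fin l.length => MvPolynomial.X (l.get k)) (fun _ : Fin 1 => MvPolynomial.rename Subtype.val F))
    ?_ ?_
  · intro k
    induction k using Fin.addCases with
    | left k => rw [killFamily, Fin.append_left]; exact hlu _ (List.get_mem l k)
    | right k => rw [killFamily, Fin.append_right]; exact hf
  · intro k
    induction k using Fin.addCases with
    | left k => rw [killFamily, Fin.append_left, Fin.append_left, hεX]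
    | right k => rw [killFamily, Fin.append_right, Fin.append_right, hfF]
  · rw [List.ofFn_fin_append, RingTheory.Sequence.isWeaklyRegular_append_iff]
    constructor
    · have h := MvPolynomial.isWeaklyRegular_map_X (R := C) l hl
      rwa [List.map_eq_ofFn_get] at h
    · rw [List.ofFn_const, List.replicate_one, RingTheory.Sequence.isWeaklyRegular_singleton_iff]
      have hideal : (Ideal.ofList (List.ofFn fun k : Fin l.length => (MvPolynomial.X (l.get k) : P)) • ⊤ :
          Submodule P P) = Ideal.span (MvPolynomial.X '' sl : Set P) := by
        rw [smul_eq_mul, Ideal.mul_top, Ideal.ofList, ← List.map_eq_ofFn_get]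
        congr 1
        ext p
        simp
      rw [hideal]
      -- `F ≠ 0` acts injectively on `C[T]/(T_l) ≅ C[T_j : j ∉ l]`, a domain
      apply isSMulRegular_quotient_of_isLeftRegular
      intro x y hxy
      apply (MvPolynomial.quotientSpanXEquiv (R := C) sl).injective
      have h := congrArg (MvPolynomial.quotientSpanXEquiv (R := C) sl) hxy
      simp only [map_mul, MvPolynomial.quotientSpanXEquiv_mk, MvPolynomial.killCompl_rename_app] at h
      exact (IsRegular.of_ne_zero' hF0).left h

end KillC

end ConeDepth

end Summit.ResolutionOfSingularities.ResolutionOfSingularities.Theorems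

end
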